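import Literature.Topology.FourManifolds.TrisectionFunctorGK
import Literature.Topology.FourManifolds.MorseDiscLemma
import Literature.Topology.FourManifolds.LickorishWallaceProofs
import Literature.AlgebraicTopology.FundamentalGroup.SphereSimplyConnected
import Literature.AlgebraicTopology.FundamentalGroup.CircleAndTorus
import Literature.Topology.FourManifolds.SurfaceGroupGenusOne
import HarnessLib

/-!
# The central surface of a Gay–Kirby trisection: non-empty, connected, and `S²` in genus `0`

Topic `Literature/Topology/FourManifolds`; sibling of `TrisectionFunctorGK.lean` and of
`TrisectionFunctorGKProofs.lean` (which serves fact (a′)), written for the fact seat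
`provefact-Literature.Topology.FourManifolds.exists-cbed50d78a` (named fact (g′)
`Literature.Topology.FourManifolds.exists_marking_centralSurface_of_gkTrisection`: for a balanced
`(g, k)`-trisection with corners along the central surface of a closed connected oriented smooth
4-manifold, the central surface `F = X₁ ∩ X₂ ∩ X₃` has a point `x₀` and a marking
`S_g ≃* π₁(F, x₀)` — Gay–Kirby 2016, Def. 1 and Remark 2: "the triple intersection
`X₁ ∩ X₂ ∩ X₃` is a surface of genus `g`", "the central genus `g` surface
`F_g = X₁ ∩ X₂ ∩ X₃ = ∂H_{ij}`"; `π₁(Σ_g) = ⟨a₁, b₁, …, a_g, b_g ∣ ∏ [aᵢ, bᵢ]⟩`, Hatcher, Prop. 1.26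
and §1.2, p. 51).

## Status

(g′) is **not** discharged here.  Its printed proof needs two theories absent from Mathlib and
from the tree: (1) the boundary of a `3`-dimensional `1`-handlebody with one `0`-handle and `g`
`1`-handles (clause (iii) of `IsGKTrisection`, Morse-theoretic `HasHandleDecomposition`) is the
closed orientable surface of genus `g` — which also requires the orientability of the handlebody
`H_{ij}`, not part of clause (iii) and only available through the corner structure of the sectors
in the oriented `X` — and (2) `π₁(Σ_g, x₀) ≅ S_g` for `g ≥ 1` (Seifert–van Kampen for a cell
model, `π₁(S¹) ≅ ℤ`).  What is proved here, sorry-free: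

* `IsGKTrisection.nonempty_and_isPreconnected_iInter`, `IsGKTrisection.nonempty_iInter`,
  `IsGKTrisection.isConnected_iInter`, `IsGKTrisection.nonempty_centralSurface`,
  `IsGKTrisection.connectedSpace_centralSurface` — **the central surface of any Gay–Kirby
  trisection (all `g`, `k`, any smooth Hausdorff `X`) is non-empty and connected**: it is the
  image `h(∂H)` of the boundary of a compact connected `3`-manifold carrying a Morse function
  adapted to the boundary all of whose critical points have index `≤ 1`, i.e. coindex `≥ 2`, and
  such a boundary is non-empty and connected
  (`IsMorseAdapted.isPreconnected_boundary_and_nonempty`, `LickorishWallaceProofs.lean`;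
  Kosinski, *Differential Manifolds* (1993), VI (11.5)).  In particular the base point `x₀` of
  (g′) always exists.
* `IsGKTrisection.isSimplyConnected_iInter_of_genus_zero` — **in genus `0` the central surface
  is simply connected**: `H` has one `0`-handle and no other handle, so `H ≅ 𝔻³`
  (`HasHandleDecomposition.nonempty_diffeomorph_closedBall_of_handleCount_one_zero`,
  `MorseDiscLemma.lean`; Milnor, *Morse theory* (1963), Thm. 3.1 with the Lemma of Morse),
  diffeomorphisms preserve the boundary (Mathlib `Diffeomorph.image_boundary`), `∂𝔻³ = S²`
  (`boundary_closedBall`, `ClosedBall.lean`) and `π₁(S²) = 1`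
  (`Literature.AlgebraicTopology.FundamentalGroup.simplyConnectedSpace_euclideanSphere`; Hatcher,
  Prop. 1.14).
* `exists_marking_centralSurface_of_gkTrisection_genusZero` and
  `exists_marking_centralSurface_of_gkTrisection_of_genus_zero` — **the clause `g = 0` of (g′),
  proved** (for every `k`, indeed for unbalanced `(0; k₀, k₁, k₂)`-trisections of any smooth
  Hausdorff `X`, no orientation or compactness needed): `S_0 = {1} ≃* π₁(F, x₀) = {1}`.  This
  generalises the marking of Gay–Kirby's explicit genus-`0` trisection of `S⁴`
  (`GayKirby.sphereSector_marking`, `SphereTrisections.lean`) to every genus-`0` trisection.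

* `exists_marking_centralSurface_of_homeomorph` — **the shape of the final assembly of (g′)**:
  if the central surface is homeomorphic to a space `T` marked by `S_g` at every point, then
  (g′) holds for `S` (`π₁` transported along the homeomorphism,
  `Literature.AlgebraicTopology.FundamentalGroup.fundamentalGroupEquivOfHomeomorph`, Hatcher
  Prop. 1.18).
* **Genus `1`, the algebraic-topology half, proved**: the torus `ℝ/ℤp × ℝ/ℤq` is marked by
  `S_1` at every base point — `torusMarking : S_1 ≃* π₁(ℝ/ℤp × ℝ/ℤq, (x, y))`, `a ↦ (ω_x, y)`,
  `b ↦ (x, ω_y)` (`torusMarking_a`, `torusMarking_b`), assembled from `π₁(T²) ≅ ℤ × ℤ`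
  (Hatcher Thm. 1.7, Prop. 1.12, Example 1.13: `CircleAndTorus.lean`) and
  `S_1 = ⟨a, b ∣ aba⁻¹b⁻¹⟩ ≅ ℤ × ℤ` (Hatcher §1.2 p. 51: `SurfaceGroupGenusOne.lean`); hence
  `exists_marking_centralSurface_of_gkTrisection_genusOne_of_homeomorph`: **(g′) for `g = 1`
  holds as soon as the central surface is homeomorphic to a torus**.  What is still missing for
  the genus-`1` clause is exactly that homeomorphism `F ≅ T²`, i.e. (1) above for `g = 1`:
  orientability of `H_{ij}`, the `1`-handle lemma `oneHandle_nonempty_diffeomorph`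
  (`HandlebodyClassification.lean`, a named fact) to identify `H_{ij}` with the model solid torus
  (`SolidTorusHandlebody.lean`), and an identification of the boundary of a model solid torus
  with `S¹ × S¹`.

Nothing here changes or weakens (g′); the cases `g ≥ 1` remain a named fact.

## References

* D. Gay, R. Kirby, *Trisecting 4-manifolds*, Geom. Topol. 20 (2016) 3097–3132
  (arXiv:1205.1565): Def. 1 and Remark 2 (p. 3098; arXiv p. 3: "the triple intersection
  `X₁ ∩ X₂ ∩ X₃` is a surface of genus `g`", "the central genus `g` surface
  `F_g = X₁ ∩ X₂ ∩ X₃ = ∂H_{ij}`"); §2, first example (the genus-`0` trisection of `S⁴`,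
  `F = S²`).
* A. Hatcher, *Algebraic Topology*, CUP 2002: Thm. 1.7 (p. 29, `π₁(S¹) ≅ ℤ`), Prop. 1.12 and
  Example 1.13 (p. 34, `π₁(S¹ × S¹) ≅ ℤ × ℤ`), Prop. 1.14 (`π₁(Sⁿ) = 0` for `n ≥ 2`), Prop. 1.18
  (p. 37), §1.2 p. 51 and Prop. 1.26 (`π₁` of `Σ_g`).
* J. Milnor, *Morse theory*, Ann. of Math. Studies 51 (1963), Thm. 3.1 and the proof of
  Thm. 4.1 (p. 25) (a manifold with a single, minimal, critical point is a disc).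
* A. A. Kosinski, *Differential Manifolds*, Academic Press (1993), VI (11.5) (the boundary of a
  handlebody with handles of small index is connected).
-/

open scoped Manifold ContDiff Topology
open Set Function

noncomputable section

namespace Literature.Topology.FourManifolds

universe u

variable {X : Type u} [TopologicalSpace X] [ChartedSpace (EuclideanSpace ℝ (Fin 4)) X]
  {g : ℕ} {k : Fin 3 → ℕ} {S : Fin 3 → Set X}

/-! ### The central surface is non-empty and connected (all genera) -/

/-- **The central surface `F = S 0 ∩ S 1 ∩ S 2` of a Gay–Kirby trisection is non-empty and
preconnected.**  By clause (iii) of `IsGKTrisection`, `F = h(∂H)` for a smooth embedding `h` of a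
compact connected smooth `3`-manifold with boundary `H` carrying a Morse function adapted to
`∂H` with one critical point of index `0`, `g` of index `1` and none of index `≥ 2` (the critical
set being finite, `IsMorse.finite_criticalSet_holds`); all critical points have coindex `≥ 2`,
so `∂H` is non-empty and preconnected (`IsMorseAdapted.isPreconnected_boundary_and_nonempty`:
the maximum of the Morse function is attained on `∂H`, and `H` minus nothing of codimension
`≤ 1` stays connected up to the top level), and so is its continuous image `F`.  Gay–Kirby,
Remark 2: "the central genus `g` surface `F_g = X₁ ∩ X₂ ∩ X₃ = ∂H_{ij}`"; Kosinski VI (11.5).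
[cite: GayKirby2016, Def. 1 and Remark 2 (p. 3098)] -/
theorem IsGKTrisection.nonempty_and_isPreconnected_iInter [T2Space X]
    (h : IsGKTrisection X g k S) : (⋂ l, S l).Nonempty ∧ IsPreconnected (⋂ l, S l) := by
  obtain ⟨H, _, _, f, hM, hH, hc, hh, hf, -, hbdry⟩ := h.2.2 0 1 (by decide)
  haveI := hM
  haveI := hH
  haveI := hc
  haveI : T2Space H := hf.isEmbedding.t2Space
  haveI : LocallyPathConnectedSpace H :=
    ChartedSpace.locallyPathConnectedSpace (EuclideanHalfSpace 3) H
  obtain ⟨φ, hφ, hcount⟩ := hh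
  have hfin : (criticalSet (𝓡∂ 3) φ).Finite := IsMorse.finite_criticalSet_holds hφ.isMorse
  have hidx : ∀ x, (𝓡∂ 3).IsInteriorPoint x → IsMCriticalPt (𝓡∂ 3) φ x →
      morseIndex (𝓡∂ 3) φ x + 2 ≤ 2 + 1 := by
    intro x _ hx
    by_contra hk
    have hk2 : 2 ≤ morseIndex (𝓡∂ 3) φ x := by omega
    have hmem : x ∈ criticalSetOfIndex (𝓡∂ 3) φ (morseIndex (𝓡∂ 3) φ x) := ⟨hx, rfl⟩
    have hfin' : (criticalSetOfIndex (𝓡∂ 3) φ (morseIndex (𝓡∂ 3) φ x)).Finite :=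
      hfin.subset (criticalSetOfIndex_subset _ φ _)
    have h0 : (criticalSetOfIndex (𝓡∂ 3) φ (morseIndex (𝓡∂ 3) φ x)).ncard = 0 := by
      rw [hcount, handleCount_of_two_le _ _ hk2]
    rw [Set.ncard_eq_zero hfin'] at h0
    rw [h0] at hmem
    exact hmem
  obtain ⟨hpre, hne⟩ := hφ.isPreconnected_boundary_and_nonempty hidx
  rw [← hbdry]
  exact ⟨hne.image f, hpre.image f hf.isEmbedding.continuous.continuousOn⟩

/-- The central surface of a Gay–Kirby trisection is non-empty (it is the non-empty boundary of
the handlebody `H₀₁`, Gay–Kirby Remark 2: `F_g = ∂H_{ij}`). [cite: GayKirby2016, Def. 1 and Remark 2 (p. 3098)] -/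
theorem IsGKTrisection.nonempty_iInter [T2Space X] (h : IsGKTrisection X g k S) :
    (⋂ l, S l).Nonempty :=
  h.nonempty_and_isPreconnected_iInter.1

/-- The central surface of a Gay–Kirby trisection is connected (Gay–Kirby Remark 2: it is the
boundary `∂H_{ij}` of a handlebody, "the central genus `g` surface"; Kosinski VI (11.5)).
[cite: GayKirby2016, Def. 1 and Remark 2 (p. 3098)] -/
theorem IsGKTrisection.isConnected_iInter [T2Space X] (h : IsGKTrisection X g k S) :
    IsConnected (⋂ l, S l) :=
  ⟨h.nonempty_and_isPreconnected_iInter.1, h.nonempty_and_isPreconnected_iInter.2⟩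

/-- The central surface of a Gay–Kirby trisection, as a space, is non-empty: the base point `x₀`
asked for by (g′) `exists_marking_centralSurface_of_gkTrisection` always exists.
[cite: GayKirby2016, Def. 1 and Remark 2 (p. 3098)] -/
theorem IsGKTrisection.nonempty_centralSurface [T2Space X] (h : IsGKTrisection X g k S) :
    Nonempty (centralSurface S) :=
  h.nonempty_iInter.to_subtype

/-- The central surface of a Gay–Kirby trisection, as a space, is connected.
[cite: GayKirby2016, Def. 1 and Remark 2 (p. 3098)] -/
theorem IsGKTrisection.connectedSpace_centralSurface [T2Space X] (h : IsGKTrisection X g k S) :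
    ConnectedSpace (centralSurface S) :=
  isConnected_iff_connectedSpace.1 h.isConnected_iInter

/-! ### Genus `0`: the central surface is a simply connected `2`-sphere -/

/-- **In genus `0` the central surface is simply connected.**  For a `(0; k₀, k₁, k₂)`-trisection
(with corners along the central surface) the handlebody `H = H₀₁` of clause (iii) has one
`0`-handle and no other handle, hence is diffeomorphic to the closed ball `𝔻³`
(`HasHandleDecomposition.nonempty_diffeomorph_closedBall_of_handleCount_one_zero`; Milnor 1963,
Thm. 3.1 with the Lemma of Morse); a diffeomorphism carries `∂H` onto `∂𝔻³ = S²`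
(`Diffeomorph.image_boundary`, `boundary_closedBall`), and `S²` is simply connected (Hatcher,
Prop. 1.14); so `F = h(∂H) ≅ ∂H ≅ S²` is simply connected.  This is the genus-`0` case of
Gay–Kirby's Remark 2 ("the triple intersection is a surface of genus `g`"), as in their first
example (§2: the genus-`0` trisection of `S⁴`, `F = {z = 0} ∩ S⁴ = S²`).
[cite: GayKirby2016, Remark 2 (p. 3098) and §2, first example] [cite: HatcherAT2002, Prop. 1.14] -/
theorem IsGKTrisection.isSimplyConnected_iInter_of_genus_zero [T2Space X]
    (h : IsGKTrisection X 0 k S) : IsSimplyConnected (⋂ l, S l) := by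
  obtain ⟨H, _, _, f, hM, hH, hc, hh, hf, -, hbdry⟩ := h.2.2 0 1 (by decide)
  haveI := hM
  haveI := hH
  haveI := hc
  haveI : T2Space H := hf.isEmbedding.t2Space
  obtain ⟨Φ⟩ := hh.nonempty_diffeomorph_closedBall_of_handleCount_one_zero (by norm_num)
  have hΦ : Φ '' (𝓡∂ 3).boundary H =
      (𝓡∂ 3).boundary (Metric.closedBall (0 : EuclideanSpace ℝ (Fin 3)) 1) :=
    Φ.image_boundary (by simp)
  have hball : IsSimplyConnected
      ((𝓡∂ 3).boundary (Metric.closedBall (0 : EuclideanSpace ℝ (Fin 3)) 1)) := by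
    rw [← Topology.IsEmbedding.subtypeVal.isSimplyConnected_image]
    have hval : Subtype.val '' (𝓡∂ 3).boundary (Metric.closedBall (0 : EuclideanSpace ℝ (Fin 3)) 1)
        = Metric.sphere (0 : EuclideanSpace ℝ (Fin 3)) 1 := by
      rw [boundary_closedBall]
      ext y
      simp only [mem_image, mem_setOf_eq, Metric.mem_sphere, dist_zero_right]
      constructor
      · rintro ⟨x, hx, rfl⟩
        exact hx
      · intro hy
        exact ⟨⟨y, Metric.mem_closedBall.2 (by rw [dist_zero_right]; exact hy.le)⟩, hy, rfl⟩
    rw [hval]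
    exact Literature.AlgebraicTopology.FundamentalGroup.simplyConnectedSpace_euclideanSphere 2 le_rfl
  rw [← hbdry, hf.isEmbedding.isSimplyConnected_image, ← Φ.toHomeomorph.isSimplyConnected_image]
  change IsSimplyConnected (Φ '' (𝓡∂ 3).boundary H)
  rw [hΦ]
  exact hball

/-- In genus `0` the central surface, as a space, is simply connected (`F ≅ S²`).
[cite: GayKirby2016, Remark 2 (p. 3098) and §2, first example] [cite: HatcherAT2002, Prop. 1.14] -/
theorem IsGKTrisection.simplyConnectedSpace_centralSurface_of_genus_zero [T2Space X]
    (h : IsGKTrisection X 0 k S) : SimplyConnectedSpace (centralSurface S) :=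
  h.isSimplyConnected_iInter_of_genus_zero

/-- **The clause `g = 0` of (g′) `exists_marking_centralSurface_of_gkTrisection`, proved.**  For a
`(0; k₀, k₁, k₂)`-trisection with corners along the central surface of a smooth Hausdorff
4-manifold `X` (no orientation, compactness or balance needed), the central surface `F` has a
point `x₀`, and `S_0 = {1} ≃* π₁(F, x₀) = {1}` since `F ≅ S²` is simply connected
(`IsGKTrisection.isSimplyConnected_iInter_of_genus_zero`) and the surface group of genus `0` is
trivial.  Gay–Kirby, Remark 2 (genus of the central surface) in genus `0`; Hatcher, Prop. 1.14
(`π₁(S²) = 0`) and §1.2 (`π₁(Σ_0) = ⟨∅ ∣ ∅⟩ = 1`).  The cases `g ≥ 1` of (g′) are not proved in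
the tree. [cite: GayKirby2016, Def. 1 and Remark 2 (p. 3098)] [cite: HatcherAT2002, Prop. 1.14 and §1.2 (p. 51)] -/
theorem exists_marking_centralSurface_of_gkTrisection_genusZero [T2Space X]
    (h : IsGKTrisection X 0 k S) :
    ∃ x₀ : centralSurface S, Nonempty (SurfaceGroup 0 ≃* FundamentalGroup (centralSurface S) x₀) := by
  haveI : SimplyConnectedSpace (centralSurface S) := h.isSimplyConnected_iInter_of_genus_zero
  obtain ⟨x, hx⟩ := h.nonempty_iInter
  refine ⟨⟨x, hx⟩, ⟨?_⟩⟩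
  letI : Unique (SurfaceGroup 0) := uniqueOfSubsingleton 1
  letI : Unique (FundamentalGroup (centralSurface S) ⟨x, hx⟩) := uniqueOfSubsingleton 1
  exact MulEquiv.ofUnique

/-- In genus `0`, **every** base point of the central surface carries a marking (the surface
group `S_0` and `π₁(F, x₀) = π₁(S², x₀)` are both trivial). [cite: GayKirby2016, Def. 1 and Remark 2 (p. 3098)]
[cite: HatcherAT2002, Prop. 1.14 and §1.2 (p. 51)] -/
theorem IsGKTrisection.nonempty_marking_of_genus_zero [T2Space X] (h : IsGKTrisection X 0 k S)
    (x₀ : centralSurface S) : Nonempty (SurfaceGroup 0 ≃* FundamentalGroup (centralSurface S) x₀) := by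
  haveI : SimplyConnectedSpace (centralSurface S) := h.isSimplyConnected_iInter_of_genus_zero
  letI : Unique (SurfaceGroup 0) := uniqueOfSubsingleton 1
  letI : Unique (FundamentalGroup (centralSurface S) x₀) := uniqueOfSubsingleton 1
  exact ⟨MulEquiv.ofUnique⟩

/-- **The clause `g = 0` of (g′) in the binder shape of the named fact**: for every closed,
connected, oriented smooth 4-manifold `X` and every balanced `(0, k)`-trisection `S` of `X` with
corners along the central surface, `∃ x₀ : F, Nonempty (S_0 ≃* π₁(F, x₀))` — i.e.
`exists_marking_centralSurface_of_gkTrisection` with its genus argument specialised to `0`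
(`exists_marking_centralSurface_of_gkTrisection_genusZero`; the extra hypotheses of the fact are
not used).  The cases `g ≥ 1` are Gay–Kirby's Remark 2 with `π₁(Σ_g) ≅ S_g` (Hatcher §1.2) and
remain a named fact. [cite: GayKirby2016, Def. 1 and Remark 2 (p. 3098)] [cite: HatcherAT2002, Prop. 1.14 and §1.2 (p. 51)] -/
theorem exists_marking_centralSurface_of_gkTrisection_of_genus_zero
    (X : Type u) [TopologicalSpace X] [T2Space X] [SecondCountableTopology X]
    [ChartedSpace (EuclideanSpace ℝ (Fin 4)) X] [IsManifold (𝓡 4) ∞ X] [CompactSpace X]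
    [ConnectedSpace X] (_o : SmoothOrientation (𝓡 4) X) (k : ℕ) (S : Fin 3 → Set X)
    (h : IsBalancedGKTrisection X 0 k S) :
    ∃ x₀ : centralSurface S, Nonempty (SurfaceGroup 0 ≃* FundamentalGroup (centralSurface S) x₀) :=
  exists_marking_centralSurface_of_gkTrisection_genusZero h.isGKTrisection

/-! ### The shape of the final assembly: markings transported along homeomorphisms -/

omit [ChartedSpace (EuclideanSpace ℝ (Fin 4)) X] in
/-- **(g′) reduced to the identification of the central surface.**  If the central surface
`F` of `S` is homeomorphic to a space `T` which is marked by `S_g` at every point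
(`S_g ≃* π₁(T, t)` for all `t`) and `F` is non-empty, then `F` has a base point `x₀` with a
marking `S_g ≃* π₁(F, x₀)`: transport along the isomorphism `π₁(F, x₀) ≅ π₁(T, e x₀)` induced by
the homeomorphism (Hatcher, Prop. 1.18).  For a Gay–Kirby trisection `F ≠ ∅` always holds
(`IsGKTrisection.nonempty_centralSurface`) and `T = Σ_g` (Gay–Kirby, Remark 2); the marking of
`Σ_g` is Hatcher §1.2, p. 51. [cite: HatcherAT2002, Prop. 1.18 (p. 37) and §1.2 p. 51] -/
theorem exists_marking_centralSurface_of_homeomorph {T : Type*} [TopologicalSpace T]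
    [Nonempty (centralSurface S)] (e : centralSurface S ≃ₜ T)
    (μ : ∀ t : T, Nonempty (SurfaceGroup g ≃* FundamentalGroup T t)) :
    ∃ x₀ : centralSurface S, Nonempty (SurfaceGroup g ≃* FundamentalGroup (centralSurface S) x₀) := by
  obtain ⟨x₀⟩ := ‹Nonempty (centralSurface S)›
  obtain ⟨ν⟩ := μ (e x₀)
  exact ⟨x₀, ⟨ν.trans
    (Literature.AlgebraicTopology.FundamentalGroup.fundamentalGroupEquivOfHomeomorph e rfl).symm⟩⟩

/-! ### Genus `1`: the torus is marked by `S_1` -/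

section GenusOne

open Literature.AlgebraicTopology.FundamentalGroup

variable {p q : ℝ}

/-- **The standard marking of the torus** `ℝ/ℤp × ℝ/ℤq` (`p, q ≠ 0`) at the base point
`(x, y)`: `S_1 = ⟨a, b ∣ aba⁻¹b⁻¹⟩ ≃* π₁(T², (x, y))`, the composite of `S_1 ≅ ℤ × ℤ`
(`surfaceGroupOneEquiv`, Hatcher §1.2 p. 51) and `π₁(T²) ≅ ℤ × ℤ` (`fundamentalGroupTorusEquiv`,
Hatcher Example 1.13); it sends `a` to the loop `(ω_x, y)` around the first factor and `b` to
`(x, ω_y)` (`torusMarking_a`, `torusMarking_b`).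
[cite: HatcherAT2002, Example 1.13 (p. 34) and §1.2 p. 51] -/
def torusMarking (hp : p ≠ 0) (hq : q ≠ 0) (x : AddCircle p) (y : AddCircle q) :
    SurfaceGroup 1 ≃* FundamentalGroup (AddCircle p × AddCircle q) (x, y) :=
  surfaceGroupOneEquiv.trans (fundamentalGroupTorusEquiv hp hq x y).symm

/-- The torus marking sends `a` to the loop winding once around the first factor.
[cite: HatcherAT2002, Example 1.13 (p. 34)] -/
theorem torusMarking_a (hp : p ≠ 0) (hq : q ≠ 0) (x : AddCircle p) (y : AddCircle q) :
    torusMarking hp hq x y (SurfaceGroup.a 0) = FundamentalGroup.fromPath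
      (Path.Homotopic.Quotient.mk ((addCircleLoop p x).prod (Path.refl y))) := by
  rw [torusMarking, MulEquiv.trans_apply, surfaceGroupOneEquiv_a, MulEquiv.symm_apply_eq,
    fundamentalGroupTorusEquiv_addCircleLoop_left]

/-- The torus marking sends `b` to the loop winding once around the second factor.
[cite: HatcherAT2002, Example 1.13 (p. 34)] -/
theorem torusMarking_b (hp : p ≠ 0) (hq : q ≠ 0) (x : AddCircle p) (y : AddCircle q) :
    torusMarking hp hq x y (SurfaceGroup.b 0) = FundamentalGroup.fromPath
      (Path.Homotopic.Quotient.mk ((Path.refl x).prod (addCircleLoop q y))) := by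
  rw [torusMarking, MulEquiv.trans_apply, surfaceGroupOneEquiv_b, MulEquiv.symm_apply_eq,
    fundamentalGroupTorusEquiv_addCircleLoop_right]

/-- The torus `ℝ/ℤp × ℝ/ℤq` is marked by `S_1` at every base point.
[cite: HatcherAT2002, Example 1.13 (p. 34) and §1.2 p. 51] -/
theorem nonempty_torusMarking (hp : p ≠ 0) (hq : q ≠ 0) (z : AddCircle p × AddCircle q) :
    Nonempty (SurfaceGroup 1 ≃* FundamentalGroup (AddCircle p × AddCircle q) z) :=
  ⟨torusMarking hp hq z.1 z.2⟩

/-- The torus `Circle × Circle ⊂ ℂ²` is marked by `S_1` at every base point.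
[cite: HatcherAT2002, Example 1.13 (p. 34) and §1.2 p. 51] -/
theorem nonempty_marking_circle_prod_circle (z : Circle × Circle) :
    Nonempty (SurfaceGroup 1 ≃* FundamentalGroup (Circle × Circle) z) :=
  nonempty_surfaceGroup_one_mulEquiv (fundamentalGroupCircleTorusEquiv z.1 z.2)

/-- **Any space homeomorphic to a torus is marked by `S_1` at every point** (Hatcher,
Example 1.13 with Prop. 1.18 and §1.2 p. 51). [cite: HatcherAT2002, Example 1.13 (p. 34) and §1.2 p. 51] -/
theorem nonempty_marking_of_homeomorph_torus {F : Type*} [TopologicalSpace F] (hp : p ≠ 0)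
    (hq : q ≠ 0) (e : F ≃ₜ AddCircle p × AddCircle q) (x₀ : F) :
    Nonempty (SurfaceGroup 1 ≃* FundamentalGroup F x₀) :=
  ⟨(torusMarking hp hq (e x₀).1 (e x₀).2).trans (fundamentalGroupEquivOfHomeomorph e rfl).symm⟩

/-- **(g′) in genus `1`, conditional on the identification of the central surface with a
torus.**  For a `(1; k₀, k₁, k₂)`-trisection with corners along the central surface of a smooth
Hausdorff 4-manifold whose central surface `F` is homeomorphic to a torus `ℝ/ℤp × ℝ/ℤq`, there
are a base point `x₀ ∈ F` and a marking `S_1 ≃* π₁(F, x₀)`.  Gay–Kirby, Remark 2, asserts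
`F ≅ Σ_1 = T²` for every genus-`1` trisection ("the triple intersection is a surface of genus
`g`"); that identification (orientability of `H_{ij}`, the `1`-handle lemma, the boundary of
the model solid torus) is the part of (g′) not yet in the tree, so this is the exact remaining
gap for `g = 1`. [cite: GayKirby2016, Def. 1 and Remark 2 (p. 3098)]
[cite: HatcherAT2002, Example 1.13 (p. 34) and §1.2 p. 51] -/
theorem exists_marking_centralSurface_of_gkTrisection_genusOne_of_homeomorph [T2Space X]
    (h : IsGKTrisection X 1 k S) (hp : p ≠ 0) (hq : q ≠ 0)
    (e : centralSurface S ≃ₜ AddCircle p × AddCircle q) :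
    ∃ x₀ : centralSurface S, Nonempty (SurfaceGroup 1 ≃* FundamentalGroup (centralSurface S) x₀) :=
  haveI := h.nonempty_centralSurface
  exists_marking_centralSurface_of_homeomorph e (nonempty_torusMarking hp hq)

end GenusOne

end Literature.Topology.FourManifolds

end
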